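import Summits.QuantumFields.YangMills.Theorems.UnitScaleTiltHalvingHSiteTopReads
import Summits.QuantumFields.YangMills.Theorems.UnitScaleTiltHalvingP1FlatCoreTopBlocksAtMember
import Summits.QuantumFields.YangMills.Theorems.UnitScaleTiltHalvingP1FlatCoreTopCubeWalks
import HarnessLib

/-!
# `hP1room` PROGRAMME (LEAD-H «H = hSupUρ3 ⟸ hSiteRows ⟸ hMember ⟸ (K-site) FULL», row «w8-19936: (G1) + (K-site-Torus)»): ★★★ THE TORUS BLOCKS (D)(E)(τ)
# OF THE TOP-STEP CALL AT THE MEMBER — the read territory `T` of the top cube (gap (G1): blocks, combs, lengths) and (K-DE) ✓`P1FlatCoreTopBlocksAtMember`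
# discharged on it from the reads ✓`HalvingHSiteTopReads.topReads_of_datum`

Route `UnitScaleTilt`, crux K1 child «MinimiserStabilityRegPr» (stmt-QuantumFields-19200), registered stub `stub_halvingStep` (`BirthV10`); cell `ym3-torus` (HUMAN RULING
D-0037: YM₃ on T³ is ladder rung R3 — NOT d = 4, NOT a mass gap, NOT the Clay problem), twin-width seat `ym-ust-19936-w8` gen 4 (successor of g3, the (K-DE) author).
`--supports stmt-QuantumFields-19200 --as helper`; THEOREMS ONLY (0 `def`, 0 `sorry`); count-neutral; nothing here claims `core′`, `hP1room(ρ3)`, `hSupU(ρ3)`,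
`hSiteRows`, the stub, the crux or the gap.

WHAT.  (K-DE) ✓p651548 reads the charted iterate `W₁` through a set `T` of `k`-sites and displays the geometry `hΛT` ∕ `hcomb` ∕ `hlen`; (G2) ✓p657279 supplies the
reads `hW₁ hWu hdet` for every fine bond whose window representative `rep b₋ := lift x₀ + rel x₀ b₋` lies in N05's top cube `□_k = cube L a M′ ρ′ k k`.  HERE:
* §1 THE READ TERRITORY `T := {π_k yc | yc ∈ Λ}`, `Λ := cubeLamS L a M′ ρ′ k k k = □_k^{(k)}` (the label box `[a − ρ′, a + M′ − 1 + ρ′]ᵈ`, ✓`B8CubeMemberZd.cubeLamS_self`):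
  ★`exists_cover_eq_flm_eq` (a fine site whose `k`-block is `π_k yc` is covered by an integer point over the label `yc` — deck arithmetic on ✓`Node00.iterBlockOf_cover`),
  ★★`rep_mem_cube_top` («`π_k s ∈ T ⇒ rep s ∈ □_k`»: ✓`B8Eq131Cubes.mem_cube_iff` + the door's left inverse ✓`P1FlatCoreTopTargetRep.rep_cover_eq_of_mem_cube`), `coverAt_mem_territory` = `hΛT`.
* §2 THE COMBS: `rel y₀ (π_k yc) = yc − c₀` with `c₀ ∈ [a, a + M′ − 1]ᵈ` the labels of `y₀ := Bᵏx₀` (`rel_coverAt_eq`; no wrap: `two_mul_le_sitesPerDir_of_room` turns the level-`0`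
  room into `2·(M′ + 1 + ρ′) ≤ |T^{(k)}|`), hence ★`l1_rel_coverAt_le` (`hlen` with `m₀ ≥ d·(M′ + ρ′)`); the label box is coordinatewise convex about `c₀`
  (★`transl_mem_territory_of_between`), and the comb never leaves the box spanned by its ends (✓`B8Ineq129.disp_prefix_treeWord_mem`, ✓`NewtonLiftFramed.walk_bond_mem_of_prefix_mem`,
  the ✓`P1FlatCoreTopCubeWalks` pattern): ★★`walk_treeWord_subset_territory` = `hcomb`.
* §3 ★★★`siteTorusBlocks_of_datum` — AT THE MEMBER (`k := K − n`, `𝔸 := M₂(ℂ)`, `τ := tr`, `W₁ := (U♯)^g` with ✓p645686's composite gauge, `y₀ := Bᵏx₀`, `Λ` as above): from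
  ✓p657279's antecedents (Theorem 4's datum with the chart-with-size row on `□_k`), ANY tower `κf` with F3's recursion∕bottom, and the (K-DE)∕(N05-WINDOWS) windows
  (`e^{c₁} − 1 ≤ s₀`, `8·3800·((d+2)L)²Lᵏs₀ ≤ 1`, `d(M′+ρ′) ≤ m₀`, `32m₀Lᵏs₀ ≤ 1`, `160(α₄ + δ + 11ω) ≤ ¼`): the blocks (D) `th hth hthk hthlo ‖th‖ hthτ` + `haxT` and (E)
  `hTop121` (`Cb := 640(α₄+δ+5ω)ω`), `hTop125` (`Cl := 10240·dL·(α₄+δ+11ω)`), `hTopReal`, `hTopTrace` in the letters of ✓`HalvingHSiteTopRowsOfSockets.siteTopRows_of_sockets` —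
  k-generic, for both (K-site) FULL composers.
HONEST SCOPE.  Integer∕torus bookkeeping + by-name composition; the window `hτ : B₀'H·‖th‖ < α₄∕4` and the JOIN windows stay the composer's.  Nothing of
[Balaban1985RegularSpaces] Prop. 5 ∕ Sect. E ∕ Theorem 4, `core′` or the stub is proved here.

References: T. Bałaban, CMP **99** (1985) 75–102 [Balaban1985RegularSpaces] (p.98, (1.131) p.99, Sect. E (1.91)–(1.92) p.98, (1.111)–(1.125) pp.95–97); CMP **98** (1985)
17–51 [Balaban1985Averaging] (pp.24–25 «Γ_{y,x}», (110) p.34); CMP **116** (1988) 1–22 [Balaban1987RG1] ((0.1) p.251); CMP **95** (1984) 17–40 [Balaban1984PropagatorsI] ((1.18) p.20).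
-/

set_option autoImplicit false

noncomputable section

open scoped BigOperators Matrix.Norms.L2Operator
open NormedSpace

namespace Summit.QuantumFields.YangMills.Theorems.HalvingHSiteTorusBlocks

open Literature.MathematicalPhysics.QuantumFieldTheory.Balaban1983to89
open Literature.MathematicalPhysics.QuantumFieldTheory.Balaban1983to89.T3ContinuumYM3Torus (T3Family)
open T4Continuum (walk walkEnd)
open B14DomainGeom (Pt)
open Node00 (coverAt coverAt_apply coverAt_zero coverAt_eq_coverAt_iff coverAt_add_period coverAt_valLift iterBlockOf_cover)
open B7Prop1Explicit (treeWord l1 e disp)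
open B7Prop1Local (InBox)
open B8Ineq130 (tlo thi)
open B8Eq131Cubes (cube mem_cube_iff flm under_flm sqLo sqHi bLo bHi gs cube_anti)
open B8CubeMemberZd (cubeLamS cubeLamS_self inBox_sq_of_mem_cubeLamS)
open B8Ineq129 (disp_prefix_treeWord_mem)
open B5Eq118OneStroke (iterBlockOf)
open B5Eq117TorusCarriers (sitesPerDir_zero_eq)
open B7Eq92Concrete (mgauge)
open B8Eq184Proof (cfgExp)
open B10Eq27TorusAxialLog (rel rel_apply transl transl_apply rel_transl_of_mem axialT gaugeActT pull unitsField toUField suIncl)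
open B15Eq112TorusCover (cover cover_apply lift cover_lift)
open LatticeFieldCalculus (siteAvgIter) open B8Eq1117Concrete (XSpace) open B8SpecialUnitaryTrace (trCLM) open MatrixLog (mlog)
open Literature.MathematicalPhysics.QuantumLattice (blockMap)
open Summit.QuantumFields.YangMills.Theorems.P1FlatCoreCubeInclusion (blockMap_pow_eq_flm cover_lift_add_rel)
open Summit.QuantumFields.YangMills.Theorems.P1FlatCoreTopTargetRep (rep_cover_eq_of_mem_cube)
open Summit.QuantumFields.YangMills.Theorems.P1FlatCoreTopCubeWalks (walkEnd_eq_transl_disp)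
open Summit.QuantumFields.YangMills.Theorems.NewtonLiftFramed (walk_bond_mem_of_prefix_mem)
open Summit.QuantumFields.YangMills.Theorems.Prop8ChartDoubleBar (dbarIterU vframeU)
open Summit.QuantumFields.YangMills.Theorems.P1FlatCoreTopBlocksAtMember
  (haxT_of_reads topTarget_of_reads hTop121_of_reads hTop125_of_reads hTopReal_of_reads hTopTrace_of_reads)
open Summit.QuantumFields.YangMills.Theorems.HalvingHSiteTopReads (topReads_of_datum)

variable {P : Params}

/-! ## §1 The read territory `T = {π_k yc | yc ∈ □_k^{(k)}}`: its fine sites have their window representatives in `□_k` -/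

section Territory

/-- ★ **THE FIBRE OF A `k`-BLOCK ON THE COVER**: if the `k`-block of the fine torus site `s` is `π_k yc`, then some integer point `z` with level-`k` label
`⌊z∕Lᵏ⌋ = yc` covers `s` (deck arithmetic: `Bᵏ(π x) = π_k ⌊x∕Lᵏ⌋`, ✓`Node00.iterBlockOf_cover`, and the period of `T_η` is `Lᵏ` times that of `T^{(k)}`).
[cite: Balaban1984PropagatorsI, (1.18) p.20; Balaban1987RG1, (0.1) p.251] -/
theorem exists_cover_eq_flm_eq {k : ℕ} (hk : k ≤ P.m + P.K) {s : Site P 0} {yc : Pt P.d} (h : iterBlockOf k s = coverAt P k yc) :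
    ∃ z : Pt P.d, cover P z = s ∧ flm P.L k z = yc := by
  have h1 : iterBlockOf k (cover P (lift P s)) = coverAt P k (flm P.L k (lift P s)) := by
    rw [iterBlockOf_cover hk, blockMap_pow_eq_flm]
  rw [cover_lift, h] at h1
  have hcong := (coverAt_eq_coverAt_iff k _ _).1 h1
  choose t ht using hcong
  refine ⟨lift P s + fun μ => ((P.sitesPerDir 0 : ℕ) : ℤ) * (-t μ), ?_, ?_⟩
  · rw [← coverAt_zero, coverAt_add_period, coverAt_zero, cover_lift]
  · funext μ
    have hL0 : ((P.L : ℤ) ^ k) ≠ 0 := pow_ne_zero _ (by exact_mod_cast P.L_pos.ne')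
    have hN : ((P.sitesPerDir 0 : ℕ) : ℤ) = (P.L : ℤ) ^ k * ((P.sitesPerDir k : ℕ) : ℤ) := by
      rw [sitesPerDir_zero_eq hk]; push_cast; ring
    have hμ := ht μ
    simp only [flm, Pi.add_apply] at hμ ⊢
    rw [hN, show lift P s μ + (P.L : ℤ) ^ k * ((P.sitesPerDir k : ℕ) : ℤ) * -t μ =
      lift P s μ + (P.L : ℤ) ^ k * (((P.sitesPerDir k : ℕ) : ℤ) * -t μ) by ring, Int.add_mul_ediv_left _ _ hL0]
    linarith

/-- ★★ **`π_k s ∈ T ⇒ rep s ∈ □_k`**: if the `k`-block of the fine site `s` is the cover of a top label `yc ∈ □_k^{(k)} = cubeLamS L a M′ ρ′ k k k`, then its window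
representative `lift x₀ + rel x₀ s` lies in N05's top cube `□_k` (the integer point over `yc` covering `s` lies in `□_k ⊆ □₀` by ✓`mem_cube_iff`, and the door's
representative is the left inverse of the cover on `□₀`, ✓`rep_cover_eq_of_mem_cube`, under the corner row `ha` and the no-wrap room).
[cite: Balaban1985RegularSpaces, p.98, (1.131) p.99; Balaban1987RG1, (0.1) p.251] -/
theorem rep_mem_cube_top {k : ℕ} (hk : k ≤ P.m + P.K) (x₀ : Site P 0) {a : Pt P.d} {M' ρ' : ℕ}
    (ha : ∀ ν, a ν ≤ ((iterBlockOf k x₀ ν).val : ℤ) ∧ ((iterBlockOf k x₀ ν).val : ℤ) ≤ a ν + M' - 1)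
    (hroom : 2 * (P.L ^ k * (M' + 1) + ρ' * gs P.L k) ≤ P.sitesPerDir 0)
    {s : Site P 0} {yc : Pt P.d} (hyc : yc ∈ cubeLamS P.L a M' ρ' k k k) (h : iterBlockOf k s = coverAt P k yc) :
    lift P x₀ + rel x₀ s ∈ cube P.L a M' ρ' k k := by
  obtain ⟨z, hzs, hz⟩ := exists_cover_eq_flm_eq hk h
  have hzk : z ∈ cube P.L a M' ρ' k k :=
    (mem_cube_iff P.L_pos).2 ⟨yc, inBox_sq_of_mem_cubeLamS hyc, hz ▸ under_flm P.L_pos k z⟩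
  have hrep := rep_cover_eq_of_mem_cube hk x₀ ha hroom (cube_anti (Nat.zero_le k) le_rfl hzk)
  rw [hzs] at hrep
  rw [hrep]
  exact hzk

/-- Set form: membership of the `k`-block in the READ TERRITORY `T := {B | ∃ yc ∈ cubeLamS L a M′ ρ′ k k k, B = π_k yc}` puts the representative in `□_k`.
[cite: Balaban1985RegularSpaces, p.98, (1.131) p.99] -/
theorem rep_mem_cube_top_of_mem {k : ℕ} (hk : k ≤ P.m + P.K) (x₀ : Site P 0) {a : Pt P.d} {M' ρ' : ℕ}
    (ha : ∀ ν, a ν ≤ ((iterBlockOf k x₀ ν).val : ℤ) ∧ ((iterBlockOf k x₀ ν).val : ℤ) ≤ a ν + M' - 1)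
    (hroom : 2 * (P.L ^ k * (M' + 1) + ρ' * gs P.L k) ≤ P.sitesPerDir 0) {s : Site P 0}
    (hs : iterBlockOf k s ∈ {B : Site P k | ∃ yc ∈ cubeLamS P.L a M' ρ' k k k, B = coverAt P k yc}) :
    lift P x₀ + rel x₀ s ∈ cube P.L a M' ρ' k k := by
  obtain ⟨yc, hyc, h⟩ := hs
  exact rep_mem_cube_top hk x₀ ha hroom hyc h

/-- `hΛT`: the top labels cover into the territory. [cite: Balaban1985RegularSpaces, (1.131) p.99] -/
theorem coverAt_mem_territory (k : ℕ) (a : Pt P.d) (M' ρ' : ℕ) :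
    ∀ yc ∈ cubeLamS P.L a M' ρ' k k k, coverAt P k yc ∈ {B : Site P k | ∃ yc ∈ cubeLamS P.L a M' ρ' k k k, B = coverAt P k yc} :=
  fun yc hyc => ⟨yc, hyc, rfl⟩

end Territory

/-! ## §2 The combs `Γ_{y₀, π_k yc}` stay in the territory and have length `≤ d·(M′ + ρ′)` -/

section Combs

/-- **THE ROOM IN LEVEL-`k` UNITS**: the level-`0` no-wrap premise `2·(Lᵏ·(M′+1) + ρ′·gs L k) ≤ |T_η|` gives `2·(M′ + 1 + ρ′) ≤ |T^{(k)}|` (`|T_η| = Lᵏ·|T^{(k)}|`,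
`gs L k ≥ Lᵏ`). [cite: Balaban1984PropagatorsI, (1.18) p.20, bookkeeping] -/
theorem two_mul_le_sitesPerDir_of_room {k : ℕ} (hk : k ≤ P.m + P.K) {M' ρ' : ℕ}
    (hroom : 2 * (P.L ^ k * (M' + 1) + ρ' * gs P.L k) ≤ P.sitesPerDir 0) : 2 * (M' + 1 + ρ') ≤ P.sitesPerDir k := by
  have hg : P.L ^ k ≤ gs P.L k :=
    Finset.single_le_sum (f := fun i => P.L ^ i) (fun _ _ => Nat.zero_le _) (Finset.self_mem_range_succ k)
  refine Nat.le_of_mul_le_mul_left ?_ (pow_pos P.L_pos k)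
  calc P.L ^ k * (2 * (M' + 1 + ρ')) = 2 * (P.L ^ k * (M' + 1) + ρ' * P.L ^ k) := by ring
    _ ≤ 2 * (P.L ^ k * (M' + 1) + ρ' * gs P.L k) := by gcongr
    _ ≤ P.sitesPerDir 0 := hroom
    _ = P.L ^ k * P.sitesPerDir k := sitesPerDir_zero_eq (P := P) hk

/-- **THE RELATIVE POSITION OF A TOP LABEL IS THE INTEGER DIFFERENCE OF LABELS** (no wrap): for `yc ∈ □_k^{(k)}`,
`rel y₀ (π_k yc) = yc − c₀` with `c₀` the labels of `y₀ = Bᵏx₀`. [cite: Balaban1985UV3, (27) p.263; Balaban1987RG1, (0.1) p.251] -/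
theorem rel_coverAt_eq {k : ℕ} (hk : k ≤ P.m + P.K) (x₀ : Site P 0) {a : Pt P.d} {M' ρ' : ℕ}
    (ha : ∀ ν, a ν ≤ ((iterBlockOf k x₀ ν).val : ℤ) ∧ ((iterBlockOf k x₀ ν).val : ℤ) ≤ a ν + M' - 1)
    (hroom : 2 * (P.L ^ k * (M' + 1) + ρ' * gs P.L k) ≤ P.sitesPerDir 0)
    {yc : Pt P.d} (hyc : yc ∈ cubeLamS P.L a M' ρ' k k k) :
    rel (iterBlockOf k x₀) (coverAt P k yc) = yc - fun μ => ((iterBlockOf k x₀ μ).val : ℤ) := by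
  have hN := two_mul_le_sitesPerDir_of_room hk hroom
  have hbox := inBox_sq_of_mem_cubeLamS hyc
  have ht : transl (iterBlockOf k x₀) (yc - fun μ => ((iterBlockOf k x₀ μ).val : ℤ)) = coverAt P k yc := by
    funext ν
    rw [transl_apply, coverAt_apply, Pi.sub_apply, Int.cast_sub, Int.cast_natCast, ZMod.natCast_zmod_val]
    abel
  rw [← ht, rel_transl_of_mem]
  intro ν
  obtain ⟨h1, h2⟩ := hbox ν
  obtain ⟨h3, h4⟩ := ha ν
  simp only [sqLo, sqHi, bLo, bHi, Nat.sub_self, pow_zero, one_mul, B8Eq131Cubes.gs_zero, mul_one] at h1 h2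
  have hNz : (2 : ℤ) * ((M' : ℤ) + 1 + ρ') ≤ (P.sitesPerDir k : ℤ) := by exact_mod_cast hN
  simp only [Pi.sub_apply, Set.mem_Ioc]
  constructor <;> linarith

/-- ★ **`hlen`: THE COMB TO A TOP LABEL HAS LENGTH `≤ d·(M′ + ρ′)`** (`|yc − c₀|_μ ≤ M′ − 1 + ρ′` in every coordinate).
[cite: Balaban1985Averaging, pp.24–25 («Γ_{y,x}»); Balaban1985RegularSpaces, (1.131) p.99] -/
theorem l1_rel_coverAt_le {k : ℕ} (hk : k ≤ P.m + P.K) (x₀ : Site P 0) {a : Pt P.d} {M' ρ' : ℕ}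
    (ha : ∀ ν, a ν ≤ ((iterBlockOf k x₀ ν).val : ℤ) ∧ ((iterBlockOf k x₀ ν).val : ℤ) ≤ a ν + M' - 1)
    (hroom : 2 * (P.L ^ k * (M' + 1) + ρ' * gs P.L k) ≤ P.sitesPerDir 0) :
    ∀ yc ∈ cubeLamS P.L a M' ρ' k k k, l1 (rel (iterBlockOf k x₀) (coverAt P k yc)) ≤ P.d * (M' + ρ') := by
  intro yc hyc
  rw [rel_coverAt_eq hk x₀ ha hroom hyc]
  have hbox := inBox_sq_of_mem_cubeLamS hyc
  unfold l1
  have hco : ∀ κ : Fin P.d, ((yc - fun μ => ((iterBlockOf k x₀ μ).val : ℤ)) κ).natAbs ≤ M' + ρ' := by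
    intro κ
    obtain ⟨h1, h2⟩ := hbox κ
    obtain ⟨h3, h4⟩ := ha κ
    simp only [sqLo, sqHi, bLo, bHi, Nat.sub_self, pow_zero, one_mul, B8Eq131Cubes.gs_zero, mul_one] at h1 h2
    have : |(yc - fun μ => ((iterBlockOf k x₀ μ).val : ℤ)) κ| ≤ (M' : ℤ) + ρ' := by
      rw [Pi.sub_apply, abs_le]; constructor <;> linarith
    have h5 : (((yc - fun μ => ((iterBlockOf k x₀ μ).val : ℤ)) κ).natAbs : ℤ) ≤ (M' : ℤ) + ρ' := by rwa [Int.natCast_natAbs]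
    exact_mod_cast h5
  calc ∑ κ, ((yc - fun μ => ((iterBlockOf k x₀ μ).val : ℤ)) κ).natAbs ≤ ∑ _κ : Fin P.d, (M' + ρ') := Finset.sum_le_sum fun κ _ => hco κ
    _ = P.d * (M' + ρ') := by rw [Finset.sum_const, Finset.card_univ, Fintype.card_fin, smul_eq_mul]

/-- ★ **THE TERRITORY IS COORDINATEWISE CONVEX ABOUT `y₀`**: for `yc ∈ □_k^{(k)}` and an integer vector `z` coordinatewise between `0` and `rel y₀ (π_k yc)`,
the translate `y₀ + z` is the cover of the top label `c₀ + z ∈ □_k^{(k)}` (the label box contains `c₀` by `ha` and is a box).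
[cite: Balaban1985RegularSpaces, p.98, (1.131) p.99; Balaban1985Averaging, pp.24–25] -/
theorem transl_mem_territory_of_between {k : ℕ} (hk : k ≤ P.m + P.K) (x₀ : Site P 0) {a : Pt P.d} {M' ρ' : ℕ}
    (ha : ∀ ν, a ν ≤ ((iterBlockOf k x₀ ν).val : ℤ) ∧ ((iterBlockOf k x₀ ν).val : ℤ) ≤ a ν + M' - 1)
    (hroom : 2 * (P.L ^ k * (M' + 1) + ρ' * gs P.L k) ≤ P.sitesPerDir 0)
    {yc : Pt P.d} (hyc : yc ∈ cubeLamS P.L a M' ρ' k k k) {z : Pt P.d}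
    (hz : ∀ μ, min 0 (rel (iterBlockOf k x₀) (coverAt P k yc) μ) ≤ z μ ∧ z μ ≤ max 0 (rel (iterBlockOf k x₀) (coverAt P k yc) μ)) :
    transl (iterBlockOf k x₀) z ∈ {B : Site P k | ∃ yc ∈ cubeLamS P.L a M' ρ' k k k, B = coverAt P k yc} := by
  rw [rel_coverAt_eq hk x₀ ha hroom hyc] at hz
  have hbox := inBox_sq_of_mem_cubeLamS hyc
  refine ⟨(fun μ => ((iterBlockOf k x₀ μ).val : ℤ)) + z, ?_, ?_⟩
  · rw [cubeLamS_self]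
    intro κ
    obtain ⟨h1, h2⟩ := hbox κ
    obtain ⟨h3, h4⟩ := ha κ
    obtain ⟨h5, h6⟩ := hz κ
    simp only [sqLo, sqHi, bLo, bHi, Nat.sub_self, pow_zero, one_mul, B8Eq131Cubes.gs_zero, mul_one, Pi.sub_apply,
      Pi.add_apply] at h1 h2 h5 h6 ⊢
    rcases le_total 0 (yc κ - ((iterBlockOf k x₀ κ).val : ℤ)) with hp | hn
    · rw [min_eq_left hp] at h5; rw [max_eq_right hp] at h6; constructor <;> linarith
    · rw [min_eq_right hn] at h5; rw [max_eq_left hn] at h6; constructor <;> linarith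
  · funext ν
    rw [transl_apply, coverAt_apply, Pi.add_apply, Int.cast_add, Int.cast_natCast, ZMod.natCast_zmod_val]

/-- every prefix position of the comb `Γ_{y₀, π_k yc}` lies in the territory. [cite: Balaban1985Averaging, pp.24–25; Balaban1984PropagatorsI, (1.7) p.18] -/
theorem walkEnd_take_treeWord_mem_territory {k : ℕ} (hk : k ≤ P.m + P.K) (x₀ : Site P 0) {a : Pt P.d} {M' ρ' : ℕ}
    (ha : ∀ ν, a ν ≤ ((iterBlockOf k x₀ ν).val : ℤ) ∧ ((iterBlockOf k x₀ ν).val : ℤ) ≤ a ν + M' - 1)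
    (hroom : 2 * (P.L ^ k * (M' + 1) + ρ' * gs P.L k) ≤ P.sitesPerDir 0)
    {yc : Pt P.d} (hyc : yc ∈ cubeLamS P.L a M' ρ' k k k) (i : ℕ) :
    walkEnd (iterBlockOf k x₀) ((treeWord (rel (iterBlockOf k x₀) (coverAt P k yc))).take i) ∈
      {B : Site P k | ∃ yc ∈ cubeLamS P.L a M' ρ' k k k, B = coverAt P k yc} := by
  rw [walkEnd_eq_transl_disp]
  exact transl_mem_territory_of_between hk x₀ ha hroom hyc fun μ =>
    disp_prefix_treeWord_mem _ (List.take_append_drop i (treeWord (rel (iterBlockOf k x₀) (coverAt P k yc)))).symm μ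

/-- ★★ **`hcomb`: THE COMBS TO THE TOP LABELS STAY IN THE TERRITORY** — every step of `walk y₀ (treeWord (rel y₀ (π_k yc)))`, `yc ∈ □_k^{(k)}`, has both bond
ends in `T`. [cite: Balaban1985Averaging, pp.24–25 («Γ_{y,x}»); Balaban1985RegularSpaces, (1.131) p.99] -/
theorem walk_treeWord_subset_territory {k : ℕ} (hk : k ≤ P.m + P.K) (x₀ : Site P 0) {a : Pt P.d} {M' ρ' : ℕ}
    (ha : ∀ ν, a ν ≤ ((iterBlockOf k x₀ ν).val : ℤ) ∧ ((iterBlockOf k x₀ ν).val : ℤ) ≤ a ν + M' - 1)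
    (hroom : 2 * (P.L ^ k * (M' + 1) + ρ' * gs P.L k) ≤ P.sitesPerDir 0) :
    ∀ yc ∈ cubeLamS P.L a M' ρ' k k k, ∀ st ∈ walk (iterBlockOf k x₀) (treeWord (rel (iterBlockOf k x₀) (coverAt P k yc))),
      st.bond.src ∈ {B : Site P k | ∃ yc ∈ cubeLamS P.L a M' ρ' k k k, B = coverAt P k yc} ∧
        st.bond.tgt ∈ {B : Site P k | ∃ yc ∈ cubeLamS P.L a M' ρ' k k k, B = coverAt P k yc} := by
  intro yc hyc st hst
  exact walk_bond_mem_of_prefix_mem {B : Site P k | ∃ yc ∈ cubeLamS P.L a M' ρ' k k k, B = coverAt P k yc} _ _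
    (fun i _ => walkEnd_take_treeWord_mem_territory hk x₀ ha hroom hyc i) st hst

end Combs

/-! ## §3 The torus blocks (D)(E)(τ) of the top-step call at the member, from Theorem 4's datum through the reads -/

section Member

open Summit.QuantumFields.YangMills.Theorems (FlatMinimizerH.le_T3)

variable {F : T3Family} {n K : ℕ}

/-- ★★★ **THE TORUS BLOCKS OF THE TOP-STEP CALL AT THE MEMBER** (see the module docstring, §3): at level `k := K − n` of the family's `K`-th torus, from
Theorem 4's datum `(u₁, W, A)` with the chart-with-size row on `□_k` (✓`topReads_of_datum`'s antecedents VERBATIM), the charted iterate `W₁ := (U♯)^g`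
(defining equation, callers write `rfl`), ANY tower `κf` of `W₁` with F3's recursion∕bottom, and the windows `e^{c₁} − 1 ≤ s₀`, `8·3800·((d+2)L)²Lᵏs₀ ≤ 1`,
`d(M′+ρ′) ≤ m₀`, `32m₀Lᵏs₀ ≤ 1`, `0 < α₄`, `160(α₄ + 8(d+2)L·Lᵏs₀ + 11·dLα₄∕2) ≤ ¼`: the blocks (D) (`th` skew, `= log v₀(W̿₁^{(k)}; y₀, π_k yc)` on `Λ`, `0` on the
lower restriction sets, `‖th‖ ≤ 16m₀Lᵏs₀`, trace-free) + `haxT`, and (E) `hTop121 hTop125 hTopReal hTopTrace` of ✓`siteTopRows_of_sockets` at `𝔸 := M₂(ℂ)`, `τ := tr`.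
[cite: Balaban1985RegularSpaces, Sect. E (1.91)-(1.92) p.98, (1.111)-(1.125) pp.95-97, (1.131) p.99; Balaban1985Averaging, pp.24-25, (110) p.34] -/
theorem siteTorusBlocks_of_datum (hnK : n < K) (x₀ : Site (F.P K) 0) {a : Pt (F.P K).d} {M' ρ' : ℕ} (hρ'1 : 1 ≤ ρ')
    (ha : ∀ ν, a ν ≤ ((iterBlockOf (K - n) x₀ ν).val : ℤ) ∧ ((iterBlockOf (K - n) x₀ ν).val : ℤ) ≤ a ν + M' - 1)
    (hroomW : 2 * ((F.P K).L ^ (K - n) * (M' + 1) + ρ' * gs (F.P K).L (K - n)) ≤ (F.P K).sitesPerDir 0)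
    (U : GaugeField (F.P K) 0 (Matrix.specialUnitaryGroup (Fin 2) ℂ)) (gJ : GaugeTransf (F.P K) 0 (Matrix.specialUnitaryGroup (Fin 2) ℂ))
    -- Theorem 4's datum `(u₁, W, A)` with the chart-with-size row on the top cube (✓`HalvingHSiteTopReads.topReads_of_datum`'s antecedents VERBATIM)
    {u₁ : Pt (F.P K).d → (Matrix (Fin 2) (Fin 2) ℂ)ˣ} {W : Pt (F.P K).d → Fin (F.P K).d → (Matrix (Fin 2) (Fin 2) ℂ)ˣ}
    {A : Pt (F.P K).d → Fin (F.P K).d → Matrix (Fin 2) (Fin 2) ℂ}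
    (hu₁SU : ∀ z, ((u₁ z : (Matrix (Fin 2) (Fin 2) ℂ)ˣ) : Matrix (Fin 2) (Fin 2) ℂ) ∈ Matrix.specialUnitaryGroup (Fin 2) ℂ)
    (hW : mgauge (1 : Pt (F.P K).d → Fin (F.P K).d → (Matrix (Fin 2) (Fin 2) ℂ)ˣ) u₁ W = pull (unitsField (toUField (GaugeField.gaugeAct gJ U))) 0)
    {η c₁ : ℝ} (hη : 0 ≤ η)
    (hchartTop : ∀ z ∈ cube (F.P K).L a M' ρ' (K - n) (K - n), ∀ ν : Fin (F.P K).d, W z ν = cfgExp η A z ν ∧ η * ‖A z ν‖ ≤ c₁)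
    -- the charted iterate `W₁ := (U♯)^g`, `g := (u₁ ∘ rep)⁻¹·(toUnits ∘ suIncl ∘ gJ)` (defining equation; callers write `rfl`)
    (W₁ : GaugeField (F.P K) 0 (Matrix (Fin 2) (Fin 2) ℂ)ˣ)
    (hW₁def : W₁ = gaugeActT (fun s => (u₁ (lift (F.P K) x₀ + rel x₀ s))⁻¹ * Unitary.toUnits (suIncl (gJ s)) :
      GaugeTransf (F.P K) 0 (Matrix (Fin 2) (Fin 2) ℂ)ˣ) (unitsField (toUField U)))
    -- the windows of (K-DE) ∕ (N05-WINDOWS): read size `s₀ ≥ e^{c₁} − 1`, the stairs budget, the comb length `m₀`, the target window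
    {s₀ : ℝ} (hs₀ : 0 ≤ s₀) (hc₁ : Real.exp c₁ - 1 ≤ s₀)
    (hbudget : 8 * 3800 * ((((F.P K).d + 2) * (F.P K).L : ℕ) : ℝ) ^ 2 * ((F.P K).L : ℝ) ^ (K - n) * s₀ ≤ 1)
    {m₀ : ℕ} (hm₀ : (F.P K).d * (M' + ρ') ≤ m₀) (hm : 32 * (m₀ : ℝ) * (((F.P K).L : ℝ) ^ (K - n) * s₀) ≤ 1)
    -- F3's effective-gauge tower of `W₁` (recursion + bottom; ✓`P1FlatCoreFrameLinLipschitz.exists_effGaugeFun`)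
    (κf : (Site (F.P K) 0 → Matrix (Fin 2) (Fin 2) ℂ) → (i : ℕ) → GaugeTransf (F.P K) i (Matrix (Fin 2) (Fin 2) ℂ)ˣ)
    (hs : ∀ (m : Site (F.P K) 0 → Matrix (Fin 2) (Fin 2) ℂ) (i : ℕ) (y : Site (F.P K) (i + 1)),
      κf m (i + 1) y = (vframeU (gaugeActT (κf m i) (dbarIterU i W₁)) y)⁻¹ * κf m i (emb y) * vframeU (dbarIterU i W₁) y)
    (h0 : ∀ (m : Site (F.P K) 0 → Matrix (Fin 2) (Fin 2) ℂ) (x : Site (F.P K) 0),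
      ((κf m 0 x : (Matrix (Fin 2) (Fin 2) ℂ)ˣ) : Matrix (Fin 2) (Fin 2) ℂ) = exp (m x))
    -- the top oscillation scale and the one window of the (E) rows
    {α₄ : ℝ} (hα₄ : 0 < α₄)
    (hr : 160 * (α₄ + 8 * ((((F.P K).d + 2) * (F.P K).L : ℕ) : ℝ) * ((F.P K).L : ℝ) ^ (K - n) * s₀ +
      11 * (((F.P K).d : ℝ) * (F.P K).L * α₄ / 2)) ≤ 1 / 4) :
    -- (D) the target block with `haxT`
    (∃ th : XSpace (F.P K).d (K - n) (Matrix (Fin 2) (Fin 2) ℂ),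
      (∀ p, star (th p) = -th p) ∧
      (∀ yc ∈ cubeLamS (F.P K).L a M' ρ' (K - n) (K - n) (K - n), th (⟨K - n, Nat.lt_succ_self (K - n)⟩, yc) =
        mlog ((axialT (dbarIterU (K - n) W₁) (iterBlockOf (K - n) x₀) (coverAt (F.P K) (K - n) yc) : (Matrix (Fin 2) (Fin 2) ℂ)ˣ) :
          Matrix (Fin 2) (Fin 2) ℂ)) ∧
      (∀ (j : ℕ) (hj : j < K - n) (y : Pt (F.P K).d), y ∈ cubeLamS (F.P K).L a M' ρ' (K - n) (K - n) j →
        th (⟨j, Nat.lt_succ_of_lt hj⟩, y) = 0) ∧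
      ‖th‖ ≤ 16 * (m₀ : ℝ) * (((F.P K).L : ℝ) ^ (K - n) * s₀) ∧
      (∀ p, trCLM (Fin 2) (th p) = 0)) ∧
    (∀ yc ∈ cubeLamS (F.P K).L a M' ρ' (K - n) (K - n) (K - n),
      ‖((axialT (dbarIterU (K - n) W₁) (iterBlockOf (K - n) x₀) (coverAt (F.P K) (K - n) yc) : (Matrix (Fin 2) (Fin 2) ℂ)ˣ) :
        Matrix (Fin 2) (Fin 2) ℂ) - 1‖ < 1) ∧
    -- (E) the four top rows in torus letters
    (∀ yc ∈ cubeLamS (F.P K).L a M' ρ' (K - n) (K - n) (K - n), ∀ l₀ : Site (F.P K) 0 → Matrix (Fin 2) (Fin 2) ℂ,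
      (∀ x : Pt (F.P K).d, InBox (tlo (F.P K).L yc (K - n)) (thi (F.P K).L yc (K - n)) x → ‖l₀ (cover (F.P K) x)‖ ≤ α₄) →
      (∀ (x : Pt (F.P K).d) (κ : Fin (F.P K).d), InBox (tlo (F.P K).L yc (K - n)) (thi (F.P K).L yc (K - n)) x →
        InBox (tlo (F.P K).L yc (K - n)) (thi (F.P K).L yc (K - n)) (x + e κ) →
        ‖l₀ (cover (F.P K) (x + e κ)) - l₀ (cover (F.P K) x)‖ ≤ α₄ * (((F.P K).L : ℝ) ^ (K - n))⁻¹) →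
      exp (mlog ((κf l₀ (K - n) (coverAt (F.P K) (K - n) yc) : (Matrix (Fin 2) (Fin 2) ℂ)ˣ) : Matrix (Fin 2) (Fin 2) ℂ)) =
          ((κf l₀ (K - n) (coverAt (F.P K) (K - n) yc) : (Matrix (Fin 2) (Fin 2) ℂ)ˣ) : Matrix (Fin 2) (Fin 2) ℂ) ∧
        ‖mlog ((κf l₀ (K - n) (coverAt (F.P K) (K - n) yc) : (Matrix (Fin 2) (Fin 2) ℂ)ˣ) : Matrix (Fin 2) (Fin 2) ℂ) -
            siteAvgIter (K - n) l₀ (coverAt (F.P K) (K - n) yc)‖ ≤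
          640 * (α₄ + 8 * ((((F.P K).d + 2) * (F.P K).L : ℕ) : ℝ) * ((F.P K).L : ℝ) ^ (K - n) * s₀ + 5 * (((F.P K).d : ℝ) * (F.P K).L * α₄ / 2)) *
            (((F.P K).d : ℝ) * (F.P K).L * α₄ / 2)) ∧
    (∀ yc ∈ cubeLamS (F.P K).L a M' ρ' (K - n) (K - n) (K - n), ∀ (l₁ l₂ : Site (F.P K) 0 → Matrix (Fin 2) (Fin 2) ℂ) (r : ℝ), 0 ≤ r →
      (∀ x : Pt (F.P K).d, InBox (tlo (F.P K).L yc (K - n)) (thi (F.P K).L yc (K - n)) x → ‖l₁ (cover (F.P K) x)‖ ≤ α₄) →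
      (∀ (x : Pt (F.P K).d) (κ : Fin (F.P K).d), InBox (tlo (F.P K).L yc (K - n)) (thi (F.P K).L yc (K - n)) x →
        InBox (tlo (F.P K).L yc (K - n)) (thi (F.P K).L yc (K - n)) (x + e κ) →
        ‖l₁ (cover (F.P K) (x + e κ)) - l₁ (cover (F.P K) x)‖ ≤ α₄ * (((F.P K).L : ℝ) ^ (K - n))⁻¹) →
      (∀ x : Pt (F.P K).d, InBox (tlo (F.P K).L yc (K - n)) (thi (F.P K).L yc (K - n)) x → ‖l₂ (cover (F.P K) x)‖ ≤ α₄) →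
      (∀ (x : Pt (F.P K).d) (κ : Fin (F.P K).d), InBox (tlo (F.P K).L yc (K - n)) (thi (F.P K).L yc (K - n)) x →
        InBox (tlo (F.P K).L yc (K - n)) (thi (F.P K).L yc (K - n)) (x + e κ) →
        ‖l₂ (cover (F.P K) (x + e κ)) - l₂ (cover (F.P K) x)‖ ≤ α₄ * (((F.P K).L : ℝ) ^ (K - n))⁻¹) →
      (∀ x : Pt (F.P K).d, InBox (tlo (F.P K).L yc (K - n)) (thi (F.P K).L yc (K - n)) x →
        ‖l₁ (cover (F.P K) x) - l₂ (cover (F.P K) x)‖ ≤ r) →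
      (∀ (x : Pt (F.P K).d) (κ : Fin (F.P K).d), InBox (tlo (F.P K).L yc (K - n)) (thi (F.P K).L yc (K - n)) x →
        InBox (tlo (F.P K).L yc (K - n)) (thi (F.P K).L yc (K - n)) (x + e κ) →
        ‖(l₁ (cover (F.P K) (x + e κ)) - l₂ (cover (F.P K) (x + e κ))) - (l₁ (cover (F.P K) x) - l₂ (cover (F.P K) x))‖ ≤
          r * (((F.P K).L : ℝ) ^ (K - n))⁻¹) →
      ‖(mlog ((κf l₁ (K - n) (coverAt (F.P K) (K - n) yc) : (Matrix (Fin 2) (Fin 2) ℂ)ˣ) : Matrix (Fin 2) (Fin 2) ℂ) -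
            siteAvgIter (K - n) l₁ (coverAt (F.P K) (K - n) yc)) -
          (mlog ((κf l₂ (K - n) (coverAt (F.P K) (K - n) yc) : (Matrix (Fin 2) (Fin 2) ℂ)ˣ) : Matrix (Fin 2) (Fin 2) ℂ) -
            siteAvgIter (K - n) l₂ (coverAt (F.P K) (K - n) yc))‖ ≤
        (10240 * (((F.P K).d : ℝ) * (F.P K).L) *
          (α₄ + 8 * ((((F.P K).d + 2) * (F.P K).L : ℕ) : ℝ) * ((F.P K).L : ℝ) ^ (K - n) * s₀ + 11 * (((F.P K).d : ℝ) * (F.P K).L * α₄ / 2))) * r) ∧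
    (∀ yc ∈ cubeLamS (F.P K).L a M' ρ' (K - n) (K - n) (K - n), ∀ l₀ : Site (F.P K) 0 → Matrix (Fin 2) (Fin 2) ℂ,
      (∀ x : Pt (F.P K).d, InBox (tlo (F.P K).L yc (K - n)) (thi (F.P K).L yc (K - n)) x → ‖l₀ (cover (F.P K) x)‖ ≤ α₄) →
      (∀ (x : Pt (F.P K).d) (κ : Fin (F.P K).d), InBox (tlo (F.P K).L yc (K - n)) (thi (F.P K).L yc (K - n)) x →
        InBox (tlo (F.P K).L yc (K - n)) (thi (F.P K).L yc (K - n)) (x + e κ) →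
        ‖l₀ (cover (F.P K) (x + e κ)) - l₀ (cover (F.P K) x)‖ ≤ α₄ * (((F.P K).L : ℝ) ^ (K - n))⁻¹) →
      mlog ((κf (fun s => -star (l₀ s)) (K - n) (coverAt (F.P K) (K - n) yc) : (Matrix (Fin 2) (Fin 2) ℂ)ˣ) : Matrix (Fin 2) (Fin 2) ℂ) -
          siteAvgIter (K - n) (fun s => -star (l₀ s)) (coverAt (F.P K) (K - n) yc) =
        -star (mlog ((κf l₀ (K - n) (coverAt (F.P K) (K - n) yc) : (Matrix (Fin 2) (Fin 2) ℂ)ˣ) : Matrix (Fin 2) (Fin 2) ℂ) -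
          siteAvgIter (K - n) l₀ (coverAt (F.P K) (K - n) yc))) ∧
    (∀ yc ∈ cubeLamS (F.P K).L a M' ρ' (K - n) (K - n) (K - n), ∀ l₀ : Site (F.P K) 0 → Matrix (Fin 2) (Fin 2) ℂ,
      (∀ s, trCLM (Fin 2) (l₀ s) = 0) →
      (∀ x : Pt (F.P K).d, InBox (tlo (F.P K).L yc (K - n)) (thi (F.P K).L yc (K - n)) x → ‖l₀ (cover (F.P K) x)‖ ≤ α₄) →
      (∀ (x : Pt (F.P K).d) (κ : Fin (F.P K).d), InBox (tlo (F.P K).L yc (K - n)) (thi (F.P K).L yc (K - n)) x →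
        InBox (tlo (F.P K).L yc (K - n)) (thi (F.P K).L yc (K - n)) (x + e κ) →
        ‖l₀ (cover (F.P K) (x + e κ)) - l₀ (cover (F.P K) x)‖ ≤ α₄ * (((F.P K).L : ℝ) ^ (K - n))⁻¹) →
      trCLM (Fin 2) (mlog ((κf l₀ (K - n) (coverAt (F.P K) (K - n) yc) : (Matrix (Fin 2) (Fin 2) ℂ)ˣ) : Matrix (Fin 2) (Fin 2) ℂ) -
        siteAvgIter (K - n) l₀ (coverAt (F.P K) (K - n) yc)) = 0) := by
  subst hW₁def
  have hk : K - n ≤ (F.P K).m + (F.P K).K := FlatMinimizerH.le_T3 F n K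
  -- the reads of the charted iterate on the territory (✓`topReads_of_datum` ∘ §1)
  have hreads := topReads_of_datum hnK x₀ hρ'1 ha hroomW U gJ hu₁SU hW hη hchartTop
  have hrd : ∀ b : PBond (F.P K) 0,
      iterBlockOf (K - n) b.src ∈ {B : Site (F.P K) (K - n) | ∃ yc ∈ cubeLamS (F.P K).L a M' ρ' (K - n) (K - n) (K - n), B = coverAt (F.P K) (K - n) yc} →
      iterBlockOf (K - n) b.tgt ∈ {B : Site (F.P K) (K - n) | ∃ yc ∈ cubeLamS (F.P K).L a M' ρ' (K - n) (K - n) (K - n), B = coverAt (F.P K) (K - n) yc} →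
      ‖((gaugeActT (fun s => (u₁ (lift (F.P K) x₀ + rel x₀ s))⁻¹ * Unitary.toUnits (suIncl (gJ s)) :
          GaugeTransf (F.P K) 0 (Matrix (Fin 2) (Fin 2) ℂ)ˣ) (unitsField (toUField U)) b : (Matrix (Fin 2) (Fin 2) ℂ)ˣ) :
          Matrix (Fin 2) (Fin 2) ℂ) - 1‖ ≤ s₀ ∧
      ((gaugeActT (fun s => (u₁ (lift (F.P K) x₀ + rel x₀ s))⁻¹ * Unitary.toUnits (suIncl (gJ s)) :
          GaugeTransf (F.P K) 0 (Matrix (Fin 2) (Fin 2) ℂ)ˣ) (unitsField (toUField U)) b : (Matrix (Fin 2) (Fin 2) ℂ)ˣ) :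
          Matrix (Fin 2) (Fin 2) ℂ) ∈ Matrix.unitaryGroup (Fin 2) ℂ ∧
      ((gaugeActT (fun s => (u₁ (lift (F.P K) x₀ + rel x₀ s))⁻¹ * Unitary.toUnits (suIncl (gJ s)) :
          GaugeTransf (F.P K) 0 (Matrix (Fin 2) (Fin 2) ℂ)ˣ) (unitsField (toUField U)) b : (Matrix (Fin 2) (Fin 2) ℂ)ˣ) :
          Matrix (Fin 2) (Fin 2) ℂ).det = 1 := fun b hb _ =>
    have h := hreads b (rep_mem_cube_top_of_mem hk x₀ ha hroomW hb)
    ⟨h.1.trans hc₁, h.2.1, h.2.2⟩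
  have hW₁ := fun b hb ht => (hrd b hb ht).1
  have hWu := fun b hb ht => (hrd b hb ht).2.1
  have hdet := fun b hb ht => (hrd b hb ht).2.2
  -- the geometry of the territory (§1, §2)
  have hΛT := coverAt_mem_territory (P := F.P K) (K - n) a M' ρ'
  have hcomb := walk_treeWord_subset_territory hk x₀ ha hroomW
  have hlen : ∀ yc ∈ cubeLamS (F.P K).L a M' ρ' (K - n) (K - n) (K - n),
      l1 (rel (iterBlockOf (K - n) x₀) (coverAt (F.P K) (K - n) yc)) ≤ m₀ :=
    fun yc hyc => (l1_rel_coverAt_le hk x₀ ha hroomW yc hyc).trans hm₀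
  have hd1 : 1 ≤ (F.P K).d := (F.P K).hd
  have hm₀1 : 1 ≤ m₀ := (Nat.one_le_iff_ne_zero.2 (Nat.mul_ne_zero (by omega) (by omega) : (F.P K).d * (M' + ρ') ≠ 0)).trans hm₀
  refine ⟨?_, ?_, ?_, ?_, ?_, ?_⟩
  · obtain ⟨th, h1, h2, h3, h4, h5⟩ := topTarget_of_reads hk _ _ hs₀ hbudget hW₁ hWu hdet (iterBlockOf (K - n) x₀)
      (cubeLamS (F.P K).L a M' ρ' (K - n) (K - n) (K - n)) hcomb hm₀1 hlen hm
    exact ⟨th, h1, h2, fun j hj y _ => h3 j hj y, h4, h5⟩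
  · exact haxT_of_reads hk _ _ hs₀ hbudget hW₁ (iterBlockOf (K - n) x₀) (cubeLamS (F.P K).L a M' ρ' (K - n) (K - n) (K - n)) hcomb hm₀1 hlen hm
  · exact hTop121_of_reads hk _ _ hs₀ hbudget hW₁ κf hs h0 _ hΛT hα₄.le hr
  · exact hTop125_of_reads hk _ _ hs₀ hbudget hW₁ κf hs h0 _ hΛT hα₄ hr
  · exact hTopReal_of_reads hk _ _ hs₀ hbudget hW₁ hWu κf hs h0 _ hΛT hα₄.le hr
  · exact hTopTrace_of_reads hk _ _ hs₀ hbudget hW₁ hdet κf hs h0 _ hΛT hα₄.le hr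

end Member

end Summit.QuantumFields.YangMills.Theorems.HalvingHSiteTorusBlocks

end
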